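import Summits.NavierStokesRegularity.NavierStokesRegularity.Theorems.EfficiencyFloorNearSaturationNearMaximiserSeqCoreHeatContinuity
import Literature.Analysis.FluidPDE.HeatDuhamelBack
import HarnessLib

/-!
# Route `EfficiencyFloor`, crux `NearSaturationNearMaximiser` (stmt-NavierStokesRegularity-25482) on the
# `ProductionEfficiencyDecay` ladder (stmt-22866): `L²` SMOOTHING BOUND FOR `Δe^{σΔ}g` (first half of the mollification estimate (HM))

Def-free helper file, eighteenth of the group. The last d-free hypothesis of the by-name reduction of stmt-25482 is the heat
mollification estimate (HM) `∫‖g − e^{tΔ}g‖² ≤ C_m·t·∫‖Dg‖²` (`…SeqCoreHeatContinuity`). Its analytic core is the `L²` bound of the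
time derivative `∂_σ e^{σΔ}g = Δe^{σΔ}g`: derivatives fall on the data (`fderiv_heatExtension_apply_eq_heatExtension_fderiv`),
`Δe^{σΔ}g = Σᵢ ∂ᵢ e^{σΔ}(∂ᵢg)`, and Young's bound `‖∂ᵥe^{σΔ}h‖₂ ≤ 2^{3/2}σ^{-1/2}‖h‖₂` (`eLpNorm_fderiv_heatExtension_apply_le`):

* `integral_norm_sq_le_of_eLpNorm_le` — `eLpNorm f 2 ≤ K · eLpNorm h 2 ⟹ ∫‖f‖² ≤ K²∫‖h‖²`;
* `laplacian_heatExtension_eq_sum` — `Δ(e^{σΔ}g)(x) = Σᵢ ∂ᵢ(e^{σΔ}∂ᵢg)(x)` for `C¹` data with `g, Dg ∈ L²`;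
* `integral_norm_sq_laplacian_heatExtension_le` — `∫‖Δe^{σΔ}g‖² ≤ 72·σ⁻¹·∫‖Dg‖²`.

What then remains of (HM): the time integration `g − e^{tΔ}g = −∫₀ᵗ Δe^{σΔ}g dσ` with the weighted Cauchy–Schwarz
`|∫₀ᵗF|² ≤ (∫₀ᵗσ^{-1/2})(∫₀ᵗσ^{1/2}|F_σ|²)`, Tonelli, and Fatou at `a → 0⁺`. HONEST FRAMING: (HM) is not yet assembled; (I) is open;
stmt-25482, `LerayFloorGap`, `ProductionEfficiencyDecay` (stmt-22866) and Navier–Stokes regularity stay OPEN; no summit statement is proved. [folklore]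
-/

-- the problem directory repeats the summit name (`NavierStokesRegularity/NavierStokesRegularity`)
set_option linter.dupNamespace false

noncomputable section

namespace Summit.NavierStokesRegularity.NavierStokesRegularity.Theorems

namespace NearSaturationNearMaximiser

namespace SeqCore

open Set MeasureTheory Filter Topology Function Real
open scoped InnerProductSpace ENNReal NNReal Laplacian
open Literature.Analysis.UnboundedOperators Literature.Analysis.FluidPDE

/-- `eLpNorm f 2 ≤ K · eLpNorm h 2` (with `K ≥ 0`, `f, h ∈ L²`) gives `∫‖f‖² ≤ K² ∫‖h‖²`. [folklore] -/
theorem integral_norm_sq_le_of_eLpNorm_le {F₁ F₂ : Type*} [NormedAddCommGroup F₁] [NormedAddCommGroup F₂]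
    {f : EuclideanSpace ℝ (Fin 3) → F₁} {h : EuclideanSpace ℝ (Fin 3) → F₂} (hf : MemLp f 2 volume) (hh : MemLp h 2 volume)
    {K : ℝ} (hK : 0 ≤ K) (hle : eLpNorm f 2 volume ≤ ENNReal.ofReal K * eLpNorm h 2 volume) :
    ∫ x, ‖f x‖ ^ 2 ≤ K ^ 2 * ∫ x, ‖h x‖ ^ 2 := by
  rw [hf.eLpNorm_eq_integral_rpow_norm (by norm_num) (by norm_num), hh.eLpNorm_eq_integral_rpow_norm (by norm_num) (by norm_num)] at hle
  simp only [ENNReal.toReal_ofNat, Real.rpow_two] at hle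
  have ha : 0 ≤ ∫ x, ‖f x‖ ^ 2 := integral_nonneg fun x => by positivity
  have hb : 0 ≤ ∫ x, ‖h x‖ ^ 2 := integral_nonneg fun x => by positivity
  rw [← one_div, ← Real.sqrt_eq_rpow, ← Real.sqrt_eq_rpow, ← ENNReal.ofReal_mul hK,
    ENNReal.ofReal_le_ofReal_iff (mul_nonneg hK (Real.sqrt_nonneg _))] at hle
  calc ∫ x, ‖f x‖ ^ 2 = (Real.sqrt (∫ x, ‖f x‖ ^ 2)) ^ 2 := (Real.sq_sqrt ha).symm
    _ ≤ (K * Real.sqrt (∫ x, ‖h x‖ ^ 2)) ^ 2 := pow_le_pow_left₀ (Real.sqrt_nonneg _) hle 2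
    _ = K ^ 2 * ∫ x, ‖h x‖ ^ 2 := by rw [mul_pow, Real.sq_sqrt hb]

/-- A partial derivative `∂ᵥg` of a `C¹` field with `‖Dg‖² ∈ L¹` lies in `L²`, with `∫‖∂ᵥg‖² ≤ ∫‖Dg‖²` for `‖v‖ ≤ 1`. [folklore] -/
theorem memLp_two_fderiv_apply_of_contDiff_one {g : EuclideanSpace ℝ (Fin 3) → EuclideanSpace ℝ (Fin 3)} (hg : ContDiff ℝ 1 g)
    (ID : Integrable (fun x => ‖fderiv ℝ g x‖ ^ 2)) {v : EuclideanSpace ℝ (Fin 3)} (hv : ‖v‖ ≤ 1) :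
    MemLp (fun x => fderiv ℝ g x v) 2 volume ∧ Integrable (fun x => ‖fderiv ℝ g x v‖ ^ 2) ∧
      ∫ x, ‖fderiv ℝ g x v‖ ^ 2 ≤ ∫ x, ‖fderiv ℝ g x‖ ^ 2 := by
  have hc : Continuous (fun x => fderiv ℝ g x v) := (hg.continuous_fderiv one_ne_zero).clm_apply continuous_const
  have hpt : ∀ x, ‖fderiv ℝ g x v‖ ^ 2 ≤ ‖fderiv ℝ g x‖ ^ 2 := fun x => by
    refine pow_le_pow_left₀ (norm_nonneg _) ?_ 2
    calc ‖fderiv ℝ g x v‖ ≤ ‖fderiv ℝ g x‖ * ‖v‖ := (fderiv ℝ g x).le_opNorm v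
      _ ≤ ‖fderiv ℝ g x‖ * 1 := by gcongr
      _ = ‖fderiv ℝ g x‖ := mul_one _
  have hI : Integrable (fun x => ‖fderiv ℝ g x v‖ ^ 2) :=
    ID.mono' (hc.norm.pow 2).aestronglyMeasurable (ae_of_all _ fun x => by
      rw [Real.norm_eq_abs, abs_of_nonneg (sq_nonneg _)]; exact hpt x)
  exact ⟨(memLp_two_iff_integrable_sq_norm hc.aestronglyMeasurable).2 hI, hI, integral_mono hI ID hpt⟩

/-- **Derivatives fall on the data, Laplacian form**: for a `C¹` field `g` with `g, Dg ∈ L²` and `σ > 0`,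
`Δ(e^{σΔ}g)(x) = Σᵢ ∂ᵢ (e^{σΔ}(∂ᵢ g))(x)` over the standard basis. [folklore] -/
theorem laplacian_heatExtension_eq_sum {g : EuclideanSpace ℝ (Fin 3) → EuclideanSpace ℝ (Fin 3)} (hg : ContDiff ℝ 1 g)
    (I2 : Integrable (fun x => ‖g x‖ ^ 2)) (ID : Integrable (fun x => ‖fderiv ℝ g x‖ ^ 2)) {σ : ℝ} (hσ : 0 < σ)
    (x : EuclideanSpace ℝ (Fin 3)) :
    (Δ (heatExtension g σ)) x = ∑ i, fderiv ℝ (heatExtension (fun y => fderiv ℝ g y (EuclideanSpace.basisFun (Fin 3) ℝ i)) σ) x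
      (EuclideanSpace.basisFun (Fin 3) ℝ i) := by
  set b := EuclideanSpace.basisFun (Fin 3) ℝ with hb
  have hg2 : MemLp g 2 volume := (memLp_two_iff_integrable_sq_norm hg.continuous.aestronglyMeasurable).2 I2
  have hsm : ContDiff ℝ 2 (heatExtension g σ) :=
    (contDiff_heatExtension_holds (E := EuclideanSpace ℝ (Fin 3)) (F := EuclideanSpace ℝ (Fin 3)) hg2 one_le_two hσ).of_le
      (by norm_cast)
  rw [laplacian_eq_sum_fderiv_fderiv_normed b hsm x]
  refine Finset.sum_congr rfl fun i _ => ?_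
  have hbi : ‖b i‖ ≤ 1 := by rw [b.orthonormal.1 i]
  have hfun : (fun y => fderiv ℝ (heatExtension g σ) y (b i)) = heatExtension (fun y => fderiv ℝ g y (b i)) σ :=
    funext fun y => fderiv_heatExtension_apply_eq_heatExtension_fderiv hg hg2 one_le_two
      (memLp_two_fderiv_apply_of_contDiff_one hg ID hbi).1 one_le_two hσ y
  rw [hfun]

/-- `‖a + b + c‖² ≤ 3(‖a‖² + ‖b‖² + ‖c‖²)`. [folklore] -/
theorem norm_add_three_sq_le {F : Type*} [NormedAddCommGroup F] (a b c : F) :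
    ‖a + b + c‖ ^ 2 ≤ 3 * (‖a‖ ^ 2 + ‖b‖ ^ 2 + ‖c‖ ^ 2) := by
  have h : ‖a + b + c‖ ≤ ‖a‖ + ‖b‖ + ‖c‖ := norm_add₃_le
  have h0 : 0 ≤ ‖a + b + c‖ := norm_nonneg _
  nlinarith [sq_nonneg (‖a‖ - ‖b‖), sq_nonneg (‖b‖ - ‖c‖), sq_nonneg (‖a‖ - ‖c‖), mul_self_le_mul_self h0 h,
    norm_nonneg a, norm_nonneg b, norm_nonneg c]

/-- **`L²` smoothing bound for `Δe^{σΔ}g`**: for a `C¹` field `g` with `g, Dg ∈ L²` and `σ > 0`, `‖Δe^{σΔ}g‖²` is integrable and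
`∫‖Δ(e^{σΔ}g)‖² ≤ 72 · σ⁻¹ · ∫‖Dg‖²` (`‖∂ᵢe^{σΔ}(∂ᵢg)‖₂ ≤ 2^{3/2}σ^{-1/2}‖∂ᵢg‖₂`, three directions, `(Σ₃)² ≤ 3Σ₃²`). [folklore] -/
theorem integral_norm_sq_laplacian_heatExtension_le {g : EuclideanSpace ℝ (Fin 3) → EuclideanSpace ℝ (Fin 3)} (hg : ContDiff ℝ 1 g)
    (I2 : Integrable (fun x => ‖g x‖ ^ 2)) (ID : Integrable (fun x => ‖fderiv ℝ g x‖ ^ 2)) {σ : ℝ} (hσ : 0 < σ) :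
    Integrable (fun x => ‖(Δ (heatExtension g σ)) x‖ ^ 2) ∧
      ∫ x, ‖(Δ (heatExtension g σ)) x‖ ^ 2 ≤ 72 * σ⁻¹ * ∫ x, ‖fderiv ℝ g x‖ ^ 2 := by
  have hbi : ∀ i, ‖EuclideanSpace.basisFun (Fin 3) ℝ i‖ ≤ 1 := fun i => by
    rw [(EuclideanSpace.basisFun (Fin 3) ℝ).orthonormal.1 i]
  -- the data `hᵢ = ∂ᵢ g ∈ L²` and the fields `Fᵢ = ∂ᵢ e^{σΔ} hᵢ ∈ L²` (kept opaque through `hF`)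
  have hh := fun i => memLp_two_fderiv_apply_of_contDiff_one hg ID (hbi i)
  obtain ⟨F, hF⟩ : ∃ F : Fin 3 → EuclideanSpace ℝ (Fin 3) → EuclideanSpace ℝ (Fin 3), ∀ i, F i = fun x =>
      fderiv ℝ (heatExtension (fun y => fderiv ℝ g y (EuclideanSpace.basisFun (Fin 3) ℝ i)) σ) x
        (EuclideanSpace.basisFun (Fin 3) ℝ i) := ⟨_, fun _ => rfl⟩
  have mF : ∀ i, MemLp (F i) 2 volume := fun i => by
    rw [hF i]; exact memLp_fderiv_heatExtension_apply (hh i).1 one_le_two hσ _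
  have IF : ∀ i, Integrable (fun x => ‖F i x‖ ^ 2) := fun i => integrable_norm_sq_of_memLp_two (mF i)
  have hFc : ∀ i, Continuous (F i) := fun i => by
    rw [hF i]
    exact ((contDiff_heatExtension_holds (E := EuclideanSpace ℝ (Fin 3)) (F := EuclideanSpace ℝ (Fin 3)) (hh i).1 one_le_two
      hσ).continuous_fderiv (by simp)).clm_apply continuous_const
  -- Young's bound for each direction
  have hfin : (Module.finrank ℝ (EuclideanSpace ℝ (Fin 3)) : ℝ) = 3 := by simp
  have hK0 : 0 ≤ (2 : ℝ) ^ ((3 : ℝ) / 2) * σ ^ (-(1 / 2 : ℝ)) := by positivity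
  have hFi : ∀ i, ∫ x, ‖F i x‖ ^ 2 ≤ ((2 : ℝ) ^ ((3 : ℝ) / 2) * σ ^ (-(1 / 2 : ℝ))) ^ 2 *
      ∫ x, ‖fderiv ℝ g x (EuclideanSpace.basisFun (Fin 3) ℝ i)‖ ^ 2 := by
    intro i
    have h := eLpNorm_fderiv_heatExtension_apply_le (hh i).1 one_le_two hσ (EuclideanSpace.basisFun (Fin 3) ℝ i)
    rw [hfin, (EuclideanSpace.basisFun (Fin 3) ℝ).orthonormal.1 i, mul_one, ← hF i] at h
    exact integral_norm_sq_le_of_eLpNorm_le (mF i) (hh i).1 hK0 h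
  have hK2 : ((2 : ℝ) ^ ((3 : ℝ) / 2) * σ ^ (-(1 / 2 : ℝ))) ^ 2 = 8 * σ⁻¹ := by
    rw [mul_pow, ← Real.rpow_natCast, ← Real.rpow_natCast, ← Real.rpow_mul (by norm_num), ← Real.rpow_mul hσ.le]
    norm_num
    rw [Real.rpow_neg_one]
  have h8 : 0 ≤ 8 * σ⁻¹ := by positivity
  have hFi' : ∀ i, ∫ x, ‖F i x‖ ^ 2 ≤ 8 * σ⁻¹ * ∫ x, ‖fderiv ℝ g x‖ ^ 2 := fun i =>
    (hFi i).trans (by rw [hK2]; exact mul_le_mul_of_nonneg_left (hh i).2.2 h8)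
  -- `Δ e^{σΔ} g = F 0 + F 1 + F 2`
  have hΔ : ∀ x, (Δ (heatExtension g σ)) x = F 0 x + F 1 x + F 2 x := fun x => by
    rw [laplacian_heatExtension_eq_sum hg I2 ID hσ x, Fin.sum_univ_three, hF 0, hF 1, hF 2]
  have hpt : ∀ x, ‖(Δ (heatExtension g σ)) x‖ ^ 2 ≤ 3 * (‖F 0 x‖ ^ 2 + ‖F 1 x‖ ^ 2 + ‖F 2 x‖ ^ 2) := fun x => by
    rw [hΔ x]; exact norm_add_three_sq_le _ _ _
  have hsumI : Integrable (fun x => 3 * (‖F 0 x‖ ^ 2 + ‖F 1 x‖ ^ 2 + ‖F 2 x‖ ^ 2)) := (((IF 0).add (IF 1)).add (IF 2)).const_mul 3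
  have hmeas : AEStronglyMeasurable (fun x => ‖(Δ (heatExtension g σ)) x‖ ^ 2) volume := by
    have heq : (fun x => ‖(Δ (heatExtension g σ)) x‖ ^ 2) = fun x => ‖F 0 x + F 1 x + F 2 x‖ ^ 2 := funext fun x => by rw [hΔ x]
    rw [heq]
    exact ((((hFc 0).add (hFc 1)).add (hFc 2)).norm.pow 2).aestronglyMeasurable
  have hInt : Integrable (fun x => ‖(Δ (heatExtension g σ)) x‖ ^ 2) :=
    hsumI.mono' hmeas (ae_of_all _ fun x => by
      rw [Real.norm_of_nonneg (sq_nonneg _)]; exact hpt x)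
  refine ⟨hInt, ?_⟩
  have I01 : Integrable (fun x => ‖F 0 x‖ ^ 2 + ‖F 1 x‖ ^ 2) := (IF 0).add (IF 1)
  have I012 : Integrable (fun x => ‖F 0 x‖ ^ 2 + ‖F 1 x‖ ^ 2 + ‖F 2 x‖ ^ 2) := I01.add (IF 2)
  have e1 : (∫ x, (‖F 0 x‖ ^ 2 + ‖F 1 x‖ ^ 2 + ‖F 2 x‖ ^ 2)) = (∫ x, (‖F 0 x‖ ^ 2 + ‖F 1 x‖ ^ 2)) + ∫ x, ‖F 2 x‖ ^ 2 :=
    integral_add I01 (IF 2)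
  have e2 : (∫ x, (‖F 0 x‖ ^ 2 + ‖F 1 x‖ ^ 2)) = (∫ x, ‖F 0 x‖ ^ 2) + ∫ x, ‖F 1 x‖ ^ 2 := integral_add (IF 0) (IF 1)
  have e3 : (∫ x, 3 * (‖F 0 x‖ ^ 2 + ‖F 1 x‖ ^ 2 + ‖F 2 x‖ ^ 2)) = 3 * ∫ x, (‖F 0 x‖ ^ 2 + ‖F 1 x‖ ^ 2 + ‖F 2 x‖ ^ 2) :=
    integral_const_mul 3 _
  have hmono : ∫ x, ‖(Δ (heatExtension g σ)) x‖ ^ 2 ≤ ∫ x, 3 * (‖F 0 x‖ ^ 2 + ‖F 1 x‖ ^ 2 + ‖F 2 x‖ ^ 2) :=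
    integral_mono_of_nonneg (ae_of_all _ fun x => by positivity) hsumI (ae_of_all _ hpt)
  have h0 := hFi' 0
  have h1 := hFi' 1
  have h2 := hFi' 2
  rw [e3, e1, e2] at hmono
  linarith

end SeqCore

end NearSaturationNearMaximiser

end Summit.NavierStokesRegularity.NavierStokesRegularity.Theorems

end
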